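import Summits.BirchSwinnertonDyer.BirchSwinnertonDyer.Theorems.CyclotomicUntwistDescendedFrobeniusTransferSemantics
import Literature.NumberTheory.EllipticCurves.FormalGroupFiniteHeightProofs
import Literature.NumberTheory.EllipticCurves.FormalGroupExpSummableProofs
import Literature.NumberTheory.EllipticCurves.FormalGroupMultiplication
import Mathlib.RingTheory.MvPowerSeries.NoZeroDivisors
import HarnessLib

/-!
# LEMMA Λ: `log_V(γ)` has bounded denominators iff `p ∣ γ` — for a `p`-integral series `γ ∈ ℚ_p⟦σ⟧` without
# constant term and an elliptic curve `V/ℤ_p` with elliptic special fibre (`p` odd)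

Cell `pub/bsd-wall` (D-0145 line `route-BirchSwinnertonDyer-CyclotomicUntwist`), width seat `bsd-line-cycu-p4` (gen 8); work
package **W2** of cycu-p3 g8's memo `Cruxes/PSRankOneLowerHalfAtThree/KATZ-FROBENIUS-MOD-VARPI-v2.md` (elementary route to
Katz's rank statement `katz_dieudonne_rank_le_two`, the residual print input of C2 = stmt-BirchSwinnertonDyer-27549 after
p633233/p634969/p635035/p635148/p635971). THEOREMS ONLY (no definition, no named fact, no `sorry`); helper `--supports` K1 =
stmt-BirchSwinnertonDyer-21580. BSD is not proved by this file and no crux / stub is.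

For `V/ℤ_p` (`p` odd) with elliptic generic and special fibres, `ℓ = log_V`, `e = exp_V`, and an integral
`γ ∈ ℚ_p⟦σ⟧` (any set of variables `σ`) with `γ(0) = 0`:

* §1 `subst_ne_zero_of_ne_zero_mv` — over a domain, `f(g) ≠ 0` for `f ∈ k⟦X⟧ ∖ 0` and `g ∈ k⟦σ⟧ ∖ 0` without
  constant term (the several-variables form of `FormalGroupFiniteHeightProofs.subst_ne_zero_of_ne_zero`);
* §2 **`isPadicInt_inv_mul_formalExp_subst_smul`** — `p⁻¹·e(p·G) ∈ ℤ_p⟦σ⟧` for integral `G` with `G(0) = 0`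
  (`‖n!·eₙ‖ ≤ 1` and `v_p(n!) ≤ n − 1`, AEC IV.6);
* §3 **`isPadicInt_formalLog_subst_smul`** (Λ, easy half) — `ℓ(p·G) ∈ ℤ_p⟦σ⟧` (`‖n·ℓₙ‖ ≤ 1`, `v_p(n) < n`);
* §4 **`isPadicInt_inv_mul_of_isPadicInt_pow_mul_formalLog_subst`** (Λ, hard half) — if `pᵐ·ℓ(γ)` is integral
  for some `m`, then `p ∣ γ` (i.e. `p⁻¹γ` is integral): `[p^{m+1}]_V(γ) = e(p^{m+1}ℓ(γ)) = e(p·(pᵐℓ(γ))) ∈ pℤ_p⟦σ⟧` by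
  §2, so `[p^{m+1}]˜(γ̄) = 0` in `𝔽_p⟦σ⟧`; `[p^{m+1}]˜ ≠ 0` (finite height,
  `FormalGroupFiniteHeightProofs.formalMul_map_toZMod_ne_zero`) and `𝔽_p⟦σ⟧` is a domain, hence `γ̄ = 0` (§1).

Use (memo §2 (iii)): for `h ∈ ℤ_p⟦X⟧`, `∂(ℓ∘h) = ℓ(h(F) ⊖ F(h,h))`, so `ℓ∘h` is of the second kind iff `h̄ ∈ End(F̄)` and
is bounded iff `h̄ = 0` — the dictionary `{second kind}/{bounded} ≅ End_{𝔽_p}(F̄) ⊗ ℚ_p` behind Katz's rank `=` height.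

References: J. H. Silverman, *AEC* IV.2.3, IV.5–IV.7, IV.6.2–6.3, V.2.3.1 [SilvermanAEC2009]; N. M. Katz, LNM 868 (1981)
§5.1, Thm 5.3.3 [Katz1981CrystallineDieudonne]; M. Hazewinkel, *Formal Groups and Applications* (1978) I §2.3 [Hazewinkel1978].
-/

set_option autoImplicit false
-- single-conjunct summit: `Summit.BirchSwinnertonDyer.BirchSwinnertonDyer.…` repeats the name by design
set_option linter.dupNamespace false

noncomputable section

open scoped Classical
open PowerSeries Nat WeierstrassCurve Literature.NumberTheory.EllipticCurves
  Summit.BirchSwinnertonDyer.BirchSwinnertonDyer.Theorems.DescendedFrobeniusTransfer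

namespace Summit.BirchSwinnertonDyer.BirchSwinnertonDyer.Theorems.FormalLogDivisibility

/-! ### §1 Substituting a non-zero series without constant term into a non-zero series (several variables) -/

/-- The constant coefficient of `f(g)` is `f(0)` when `g(0) = 0` (several variables). [folklore] -/
theorem constantCoeff_subst_mv {k : Type*} [CommRing k] {σ : Type*} (f : k⟦X⟧) {g : MvPowerSeries σ k}
    (hg0 : MvPowerSeries.constantCoeff g = 0) :
    MvPowerSeries.constantCoeff (f.subst g) = constantCoeff f := by
  rw [← MvPowerSeries.coeff_zero_eq_constantCoeff_apply, mvCoeff_subst_eq_sum_ring hg0 f 0]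
  simp [coeff_zero_eq_constantCoeff]

/-- **`f(g) ≠ 0`** for `f ≠ 0` in one variable and `g ≠ 0` in several variables without constant term, over a ring
without zero divisors: `f = Xⁿ·f₁` with `f₁(0) ≠ 0`, so `f(g) = gⁿ·f₁(g)` with `f₁(g)(0) = f₁(0) ≠ 0`. [folklore] -/
theorem subst_ne_zero_of_ne_zero_mv {k : Type*} [CommRing k] [NoZeroDivisors k] {σ : Type*} {f : k⟦X⟧}
    (hf : f ≠ 0) {g : MvPowerSeries σ k} (hg0 : MvPowerSeries.constantCoeff g = 0) (hg : g ≠ 0) :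
    f.subst g ≠ 0 := by
  have hs : HasSubst g := HasSubst.of_constantCoeff_zero hg0
  have hf' : f = X ^ f.order.toNat * divXPowOrder f := X_pow_order_mul_divXPowOrder.symm
  have hc : constantCoeff (divXPowOrder f) ≠ 0 := by
    rw [ne_eq, constantCoeff_divXPowOrder_eq_zero_iff]; exact hf
  intro h
  rw [hf', subst_mul hs, subst_pow hs, subst_X hs] at h
  rcases mul_eq_zero.mp h with h1 | h2
  · exact hg (eq_zero_of_pow_eq_zero h1)
  · have := congrArg MvPowerSeries.constantCoeff h2
    rw [constantCoeff_subst_mv _ hg0, map_zero] at this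
    exact hc this

/-! ### §2 `p⁻¹ · exp_V(p·G)` is integral -/

section Curve

variable {p : ℕ} [hp : Fact p.Prime] (W : WeierstrassCurve ℚ_[p]) [hW : W.IsIntegral ℤ_[p]]

/-- `‖p^{n−1}‖ ≤ ‖n!‖` in `ℚ_p` for `n ≥ 1` (`v_p(n!) ≤ n − 1`, Legendre; AEC IV.6.2). [cite: SilvermanAEC2009, IV.6.2] -/
theorem norm_p_pow_pred_le_norm_factorial {n : ℕ} (hn : n ≠ 0) :
    ‖(p : ℚ_[p]) ^ (n - 1)‖ ≤ ‖((n ! : ℕ) : ℚ_[p])‖ := by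
  have hp1 : (1 : ℝ) < p := by exact_mod_cast hp.out.one_lt
  have hfact : ((n ! : ℕ) : ℚ_[p]) ≠ 0 := by exact_mod_cast (Nat.factorial_pos n).ne'
  have hv : padicValNat p n ! < n := padicValNat_factorial_lt_of_ne_zero p hn
  rw [Padic.norm_p_pow, Padic.norm_eq_zpow_neg_valuation hfact, Padic.valuation_natCast]
  exact zpow_le_zpow_right₀ hp1.le (by omega)

/-- `‖pⁿ‖ ≤ ‖n‖` in `ℚ_p` for `n ≥ 1` (`v_p(n) < n`). [cite: SilvermanAEC2009, IV.6.2] -/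
theorem norm_p_pow_le_norm_natCast {n : ℕ} (hn : 0 < n) : ‖(p : ℚ_[p]) ^ n‖ ≤ ‖(n : ℚ_[p])‖ := by
  have hp1 : (1 : ℝ) < p := by exact_mod_cast hp.out.one_lt
  have hn0 : ((n : ℕ) : ℚ_[p]) ≠ 0 := by exact_mod_cast hn.ne'
  have hv : padicValNat p n < n := by
    have h1 := Nat.le_of_dvd hn (pow_padicValNat_dvd (p := p) (n := n))
    have h2 := Nat.lt_pow_self hp.out.one_lt (n := padicValNat p n)
    omega
  rw [Padic.norm_p_pow, Padic.norm_eq_zpow_neg_valuation hn0, Padic.valuation_natCast]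
  exact zpow_le_zpow_right₀ hp1.le (by omega)

/-- **`p⁻¹·exp_W(p·G) ∈ ℤ_p⟦σ⟧`** for an integral `G ∈ ℚ_p⟦σ⟧` without constant term: the `n`-th term of
`exp_W(pG) = Σ eₙ pⁿ Gⁿ` has norm `≤ p^{v_p(n!) − n} ≤ p⁻¹` for `n ≥ 1` (`‖n!·eₙ‖ ≤ 1`, AEC IV.6.3(b) with `v(p) = 1`,
`p` odd or not), and `e₀ = 0`. [cite: SilvermanAEC2009, IV.6.3] -/
theorem isPadicInt_inv_mul_formalExp_subst_smul {σ : Type*} {G : MvPowerSeries σ ℚ_[p]} (hG : IsPadicInt G)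
    (hG0 : MvPowerSeries.constantCoeff G = 0) :
    IsPadicInt (MvPowerSeries.C (p : ℚ_[p])⁻¹ * W.formalExp.subst ((p : ℚ_[p]) • G)) := by
  intro d
  have hpG : (p : ℚ_[p]) • G = MvPowerSeries.C (p : ℚ_[p]) * G := by
    rw [MvPowerSeries.smul_eq_C_mul]
  have hpG0 : MvPowerSeries.constantCoeff ((p : ℚ_[p]) • G) = 0 := by
    rw [hpG, map_mul, hG0, mul_zero]
  rw [MvPowerSeries.coeff_C_mul, mvCoeff_subst_eq_sum_ring hpG0, Finset.mul_sum]
  refine IsUltrametricDist.norm_sum_le_of_forall_le_of_nonneg zero_le_one fun n _ ↦ ?_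
  rcases Nat.eq_zero_or_pos n with rfl | hn
  · rw [coeff_zero_eq_constantCoeff, W.constantCoeff_formalExp, zero_mul, mul_zero, norm_zero]
    exact zero_le_one
  · have hpow : MvPowerSeries.coeff d (((p : ℚ_[p]) • G) ^ n) = (p : ℚ_[p]) ^ n * MvPowerSeries.coeff d (G ^ n) := by
      rw [smul_pow, MvPowerSeries.coeff_smul]
    rw [hpow]
    have e : (p : ℚ_[p])⁻¹ * (coeff n W.formalExp * ((p : ℚ_[p]) ^ n * MvPowerSeries.coeff d (G ^ n))) =
        ((p : ℚ_[p]) ^ (n - 1) * coeff n W.formalExp) * MvPowerSeries.coeff d (G ^ n) := by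
      have hp0 : (p : ℚ_[p]) ≠ 0 := by exact_mod_cast hp.out.ne_zero
      obtain ⟨k, rfl⟩ := Nat.exists_eq_succ_of_ne_zero hn.ne'
      rw [Nat.succ_sub_one, pow_succ]
      field_simp
    rw [e, norm_mul]
    have h1 : ‖(p : ℚ_[p]) ^ (n - 1) * coeff n W.formalExp‖ ≤ 1 := by
      calc ‖(p : ℚ_[p]) ^ (n - 1) * coeff n W.formalExp‖
          = ‖(p : ℚ_[p]) ^ (n - 1)‖ * ‖coeff n W.formalExp‖ := norm_mul _ _
        _ ≤ ‖((n ! : ℕ) : ℚ_[p])‖ * ‖coeff n W.formalExp‖ :=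
            mul_le_mul_of_nonneg_right (norm_p_pow_pred_le_norm_factorial hn.ne') (norm_nonneg _)
        _ = ‖((n ! : ℕ) : ℚ_[p]) * coeff n W.formalExp‖ := (norm_mul _ _).symm
        _ ≤ 1 := W.norm_factorial_mul_coeff_formalExp_le_one n
    have h2 : ‖MvPowerSeries.coeff d (G ^ n)‖ ≤ 1 := hG.pow n d
    calc _ ≤ 1 * 1 := mul_le_mul h1 h2 (norm_nonneg _) zero_le_one
      _ = 1 := mul_one _

/-! ### §3 Λ, easy half: `log_W(p·G)` is integral -/

/-- **`log_W(p·G) ∈ ℤ_p⟦σ⟧`** for integral `G` without constant term: `‖ℓₙ pⁿ‖ ≤ ‖pⁿ‖/‖n‖ ≤ 1`.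
[cite: SilvermanAEC2009, IV.6.3] -/
theorem isPadicInt_formalLog_subst_smul {σ : Type*} {G : MvPowerSeries σ ℚ_[p]} (hG : IsPadicInt G)
    (hG0 : MvPowerSeries.constantCoeff G = 0) :
    IsPadicInt (W.formalLog.subst ((p : ℚ_[p]) • G)) := by
  intro d
  have hpG0 : MvPowerSeries.constantCoeff ((p : ℚ_[p]) • G) = 0 := by
    rw [MvPowerSeries.smul_eq_C_mul, map_mul, hG0, mul_zero]
  rw [mvCoeff_subst_eq_sum_ring hpG0]
  refine IsUltrametricDist.norm_sum_le_of_forall_le_of_nonneg zero_le_one fun n _ ↦ ?_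
  rcases Nat.eq_zero_or_pos n with rfl | hn
  · rw [coeff_zero_eq_constantCoeff, W.constantCoeff_formalLog, zero_mul, norm_zero]
    exact zero_le_one
  rw [smul_pow, MvPowerSeries.coeff_smul, ← mul_assoc, norm_mul]
  have h1 : ‖coeff n W.formalLog * (p : ℚ_[p]) ^ n‖ ≤ 1 := by
    calc ‖coeff n W.formalLog * (p : ℚ_[p]) ^ n‖ = ‖(p : ℚ_[p]) ^ n‖ * ‖coeff n W.formalLog‖ := by
            rw [norm_mul, mul_comm]
      _ ≤ ‖(n : ℚ_[p])‖ * ‖coeff n W.formalLog‖ :=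
            mul_le_mul_of_nonneg_right (norm_p_pow_le_norm_natCast hn) (norm_nonneg _)
      _ = ‖(n : ℚ_[p]) * coeff n W.formalLog‖ := (norm_mul _ _).symm
      _ ≤ 1 := W.norm_natCast_mul_coeff_formalLog_le n
  calc _ ≤ 1 * 1 := mul_le_mul h1 (hG.pow n d) (norm_nonneg _) zero_le_one
    _ = 1 := mul_one _

end Curve

/-! ### §4 Λ, hard half: `pᵐ·log_V(γ)` integral ⟹ `p ∣ γ` -/

section Hard

variable {p : ℕ} [hp : Fact p.Prime] (V : WeierstrassCurve ℤ_[p])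
  [hE : (V.map PadicInt.Coe.ringHom).IsElliptic] [hEt : (V.map PadicInt.toZMod).IsElliptic]

/-- An integral series `F ∈ ℤ_p⟦σ⟧` with `p⁻¹·F` integral reduces to `0` modulo `p`. [folklore] -/
theorem map_toZMod_eq_zero_of_isPadicInt_inv_mul {σ : Type*} (F : MvPowerSeries σ ℤ_[p])
    (h : IsPadicInt (MvPowerSeries.C (p : ℚ_[p])⁻¹ * F.map (PadicInt.Coe.ringHom (p := p)))) :
    F.map (PadicInt.toZMod (p := p)) = 0 := by
  have hp0 : (p : ℚ_[p]) ≠ 0 := by exact_mod_cast hp.out.ne_zero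
  have hp1 : (1 : ℝ) < p := by exact_mod_cast hp.out.one_lt
  ext d
  rw [MvPowerSeries.coeff_map, MvPowerSeries.coeff_zero, ← RingHom.mem_ker, PadicInt.ker_toZMod,
    IsLocalRing.mem_maximalIdeal, PadicInt.mem_nonunits]
  have hd := h d
  rw [MvPowerSeries.coeff_C_mul, MvPowerSeries.coeff_map, norm_mul, norm_inv, Padic.norm_p, inv_inv] at hd
  have hx : ‖(PadicInt.Coe.ringHom (p := p)) (MvPowerSeries.coeff d F)‖ ≤ (p : ℝ)⁻¹ := by
    have hppos : (0 : ℝ) < p := by positivity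
    calc ‖(PadicInt.Coe.ringHom (p := p)) (MvPowerSeries.coeff d F)‖
        = (p : ℝ)⁻¹ * ((p : ℝ) * ‖(PadicInt.Coe.ringHom (p := p)) (MvPowerSeries.coeff d F)‖) := by
          field_simp
      _ ≤ (p : ℝ)⁻¹ * 1 := by gcongr
      _ = (p : ℝ)⁻¹ := mul_one _
  calc ‖MvPowerSeries.coeff d F‖ = ‖(PadicInt.Coe.ringHom (p := p)) (MvPowerSeries.coeff d F)‖ := rfl
    _ ≤ (p : ℝ)⁻¹ := hx
    _ < 1 := inv_lt_one_of_one_lt₀ hp1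

/-- A series `F ∈ ℤ_p⟦σ⟧` reducing to `0` modulo `p` has `p⁻¹·F` integral. [folklore] -/
theorem isPadicInt_inv_mul_of_map_toZMod_eq_zero {σ : Type*} (F : MvPowerSeries σ ℤ_[p])
    (h : F.map (PadicInt.toZMod (p := p)) = 0) :
    IsPadicInt (MvPowerSeries.C (p : ℚ_[p])⁻¹ * F.map (PadicInt.Coe.ringHom (p := p))) := by
  intro d
  have hd : PadicInt.toZMod (MvPowerSeries.coeff d F) = 0 := by
    have := congrArg (MvPowerSeries.coeff d) h
    rwa [MvPowerSeries.coeff_map, MvPowerSeries.coeff_zero] at this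
  rw [← RingHom.mem_ker, PadicInt.ker_toZMod, IsLocalRing.mem_maximalIdeal, PadicInt.mem_nonunits,
    PadicInt.norm_lt_one_iff_dvd] at hd
  obtain ⟨y, hy⟩ := hd
  have hp0 : (p : ℚ_[p]) ≠ 0 := by exact_mod_cast hp.out.ne_zero
  rw [MvPowerSeries.coeff_C_mul, MvPowerSeries.coeff_map, hy, map_mul, map_natCast, ← mul_assoc,
    inv_mul_cancel₀ hp0, one_mul]
  exact PadicInt.norm_le_one y

/-- **LEMMA Λ (hard half).** Let `V/ℤ_p` (`p` odd) have elliptic generic and special fibres, `ℓ = log_V`, and let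
`γ ∈ ℚ_p⟦σ⟧` be integral without constant term. If `pᵐ·ℓ(γ)` is integral for some `m`, then `p ∣ γ`, i.e. `p⁻¹·γ` is
integral: `[p^{m+1}](γ) = exp(p·pᵐℓ(γ)) ∈ pℤ_p⟦σ⟧` (§2, `exp ∘ ℓ = id`, `ℓ∘[N] = N·ℓ`), so `[p^{m+1}]˜(γ̄) = 0` over
`𝔽_p`, while `[p^{m+1}]˜ ≠ 0` (finite height) — hence `γ̄ = 0` (§1). [cite: SilvermanAEC2009, IV.6.3 and IV.7]
[cite: Katz1981CrystallineDieudonne, Thm. 5.3.3] -/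
theorem isPadicInt_inv_mul_of_isPadicInt_pow_mul_formalLog_subst (hp2 : p ≠ 2) {σ : Type*}
    {γ : MvPowerSeries σ ℚ_[p]} (hγ : IsPadicInt γ) (hγ0 : MvPowerSeries.constantCoeff γ = 0) {m : ℕ}
    (h : IsPadicInt (MvPowerSeries.C ((p : ℚ_[p]) ^ m) *
      (V.map PadicInt.Coe.ringHom).formalLog.subst γ)) :
    IsPadicInt (MvPowerSeries.C (p : ℚ_[p])⁻¹ * γ) := by
  set W := V.map (PadicInt.Coe.ringHom (p := p)) with hWdef
  haveI : W.IsIntegral ℤ_[p] := ⟨⟨V, rfl⟩⟩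
  set N : ℕ := p ^ (m + 1) with hN
  have hN0 : 0 < N := pow_pos hp.out.pos _
  have hp0 : (p : ℚ_[p]) ≠ 0 := by exact_mod_cast hp.out.ne_zero
  -- substitution data
  have hγs : HasSubst γ := HasSubst.of_constantCoeff_zero hγ0
  have hℓ0 : constantCoeff W.formalLog = 0 := W.constantCoeff_formalLog
  have hℓs : HasSubst W.formalLog := HasSubst.of_constantCoeff_zero' hℓ0
  have hM0 : constantCoeff (W.formalMul N) = 0 := W.constantCoeff_formalMul N
  have hMs : HasSubst (W.formalMul N) := HasSubst.of_constantCoeff_zero' hM0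
  -- `[N] = exp(N·ℓ)`
  have hMexp : W.formalMul N = W.formalExp.subst ((N : ℚ_[p]) • W.formalLog) := by
    have h1 := congrArg (PowerSeries.subst (W.formalMul N)) W.formalExp_subst_formalLog
    rw [subst_comp_subst_apply hℓs hMs, W.formalLog_subst_formalMul, subst_X hMs] at h1
    rw [← h1, nsmul_eq_mul, ← map_natCast (C (R := ℚ_[p])), ← smul_eq_C_mul]
  -- `[N](γ) = exp(p·G)`, `G = pᵐ·ℓ(γ)` integral
  set G : MvPowerSeries σ ℚ_[p] := MvPowerSeries.C ((p : ℚ_[p]) ^ m) * W.formalLog.subst γ with hGdef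
  have hℓγ0 : MvPowerSeries.constantCoeff (W.formalLog.subst γ) = 0 :=
    PowerSeries.constantCoeff_subst_eq_zero hγ0 _ hℓ0
  have hG0 : MvPowerSeries.constantCoeff G = 0 := by
    rw [hGdef, map_mul, hℓγ0, mul_zero]
  have hNℓs : HasSubst ((N : ℚ_[p]) • W.formalLog) := by
    refine HasSubst.of_constantCoeff_zero' ?_
    rw [smul_eq_C_mul, map_mul, hℓ0, mul_zero]
  have hMγ : (W.formalMul N).subst γ = W.formalExp.subst ((p : ℚ_[p]) • G) := by
    rw [hMexp, subst_comp_subst_apply hNℓs hγs, subst_smul hγs, hGdef, hN, pow_succ, Nat.cast_mul,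
      Nat.cast_pow, mul_comm ((p : ℚ_[p]) ^ m), ← smul_smul, MvPowerSeries.smul_eq_C_mul,
      MvPowerSeries.smul_eq_C_mul, MvPowerSeries.smul_eq_C_mul]
  have hint : IsPadicInt (MvPowerSeries.C (p : ℚ_[p])⁻¹ * (W.formalMul N).subst γ) := by
    rw [hMγ]; exact isPadicInt_inv_mul_formalExp_subst_smul W h hG0
  -- read over `ℤ_p` and reduce modulo `p`
  obtain ⟨γ₀, rfl⟩ := isPadicInt_iff_exists_map.mp hγ
  have hγ₀0 : MvPowerSeries.constantCoeff γ₀ = 0 := by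
    have : (PadicInt.Coe.ringHom (p := p)) (MvPowerSeries.constantCoeff γ₀) = 0 := by
      rwa [← MvPowerSeries.constantCoeff_map]
    exact PadicInt.coe_eq_zero.mp this
  have hγ₀s : HasSubst γ₀ := HasSubst.of_constantCoeff_zero hγ₀0
  have hP : ((V.formalMul N).subst γ₀).map (PadicInt.Coe.ringHom (p := p)) = (W.formalMul N).subst
      (γ₀.map (PadicInt.Coe.ringHom (p := p))) := by
    rw [PowerSeries.map_subst hγ₀s, V.map_formalMul]
  rw [← hP] at hint
  have hred := map_toZMod_eq_zero_of_isPadicInt_inv_mul _ hint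
  rw [PowerSeries.map_subst hγ₀s, V.map_formalMul] at hred
  -- `[N]˜ ≠ 0` and `𝔽_p⟦σ⟧` is a domain ⟹ `γ̄ = 0`
  have hFne : (V.map PadicInt.toZMod).formalMul N ≠ 0 := V.formalMul_map_toZMod_ne_zero hp2 hN0
  have hγbar0 : MvPowerSeries.constantCoeff (γ₀.map (PadicInt.toZMod (p := p))) = 0 := by
    rw [MvPowerSeries.constantCoeff_map, hγ₀0, map_zero]
  have hγbar : γ₀.map (PadicInt.toZMod (p := p)) = 0 := by
    by_contra hne
    exact subst_ne_zero_of_ne_zero_mv hFne hγbar0 hne hred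
  exact isPadicInt_inv_mul_of_map_toZMod_eq_zero γ₀ hγbar

/-- **LEMMA Λ (both halves), `m = 0` normal form.** For `V/ℤ_p` (`p` odd, elliptic fibres) and an integral
`γ ∈ ℚ_p⟦σ⟧` without constant term: `p⁻¹·γ` is integral iff `pᵐ·log_V(γ)` is integral for some `m` (and then
`log_V(γ)` itself is integral). [cite: SilvermanAEC2009, IV.6.3 and IV.7] [cite: Katz1981CrystallineDieudonne, Thm. 5.3.3] -/
theorem isPadicInt_inv_mul_iff_exists_isPadicInt_pow_mul_formalLog_subst (hp2 : p ≠ 2) {σ : Type*}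
    {γ : MvPowerSeries σ ℚ_[p]} (hγ : IsPadicInt γ) (hγ0 : MvPowerSeries.constantCoeff γ = 0) :
    IsPadicInt (MvPowerSeries.C (p : ℚ_[p])⁻¹ * γ) ↔
      ∃ m : ℕ, IsPadicInt (MvPowerSeries.C ((p : ℚ_[p]) ^ m) * (V.map PadicInt.Coe.ringHom).formalLog.subst γ) := by
  constructor
  · intro h
    refine ⟨0, ?_⟩
    have hp0 : (p : ℚ_[p]) ≠ 0 := by exact_mod_cast hp.out.ne_zero
    haveI : (V.map (PadicInt.Coe.ringHom (p := p))).IsIntegral ℤ_[p] := ⟨⟨V, rfl⟩⟩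
    have hG0 : MvPowerSeries.constantCoeff (MvPowerSeries.C (p : ℚ_[p])⁻¹ * γ) = 0 := by
      rw [map_mul, hγ0, mul_zero]
    have e : γ = (p : ℚ_[p]) • (MvPowerSeries.C (p : ℚ_[p])⁻¹ * γ) := by
      rw [MvPowerSeries.smul_eq_C_mul, ← mul_assoc, ← map_mul, mul_inv_cancel₀ hp0, map_one, one_mul]
    rw [pow_zero, map_one, one_mul, e]
    exact isPadicInt_formalLog_subst_smul _ h hG0
  · rintro ⟨m, hm⟩
    exact isPadicInt_inv_mul_of_isPadicInt_pow_mul_formalLog_subst V hp2 hγ hγ0 hm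

end Hard

end Summit.BirchSwinnertonDyer.BirchSwinnertonDyer.Theorems.FormalLogDivisibility

end
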